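import Summits.KontsevichZagierPeriods.KontsevichZagierPeriods.Theorems.GrothendieckSectorComplementRingJoin

/-!
# Stub-ideation k=2 (FAMILY 2 — RESHAPE) for `stub_ringRemainder`
# (crux `Grothendieck.SectorComplement`, stmt-KontsevichZagierPeriods-11102)

Elaboration sanity check of the helper-lemma STATEMENTS proposed in
`STUB-IDEAS-stub_ringRemainder-2.md`. Nothing here is proved (sorries in helper lemmas only);
the assembly `stub_ringRemainder_of_forall_kernelOn` is a real term.
-/

noncomputable section

open Set
open Literature.NumberTheory.Transcendental
open Literature.NumberTheory.Transcendental.KZ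
open MvPolynomial (aeval X C rename)
open Summit.KontsevichZagierPeriods.Grothendieck.GpcLegendreLemniscaticNegative (kRep eRep)
open Summit.KontsevichZagierPeriods.Grothendieck.LemniscaticSectorGlue
open Summit.KontsevichZagierPeriods.Grothendieck.SectorComplementAmalgamation
open Summit.KontsevichZagierPeriods.MzvKernelInKZ.Negative
open Summit.KontsevichZagierPeriods.Grothendieck.SectorComplementRingJoin

namespace Summit.KontsevichZagierPeriods.Grothendieck.SectorComplementRingJoin.StubIdeas2

/-! ## Plan A — ideal-certificate normal form (reformulate + change the induction variable) -/

/-- Conjecture 1 in kernel form ON THE SECTOR `ℤ[v] ⊆ P` generated by a finite family `v` of formal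
periods (the shape of every landed sector: `kPiRingKernel`, `stub_lemRingKernel`, `piRootRing`). -/
def KernelOn {k : ℕ} (v : Fin k → FormalPeriodRing) : Prop :=
  ∀ P : MvPolynomial (Fin k) ℤ, evalP (aeval v P) = 0 → aeval v P = 0

/-- H0 (bookkeeping, XS): `evalP` commutes with integer polynomial evaluation. -/
theorem evalP_aeval_eq {k : ℕ} (v : Fin k → FormalPeriodRing) (P : MvPolynomial (Fin k) ℤ) :
    evalP (aeval v P) = aeval (fun i => evalP (v i)) P := by
  sorry

/-- H1 (local-to-global, S): the summit is `KernelOn` for every finite family of classes of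
representations of KZ's literal (rational) shape. (→) injectivity of `evalP`;
(←) the instance `k = 2`, `P = X 0 - X 1` is verbatim the summit via
`kzKernelConjecture_iff_isRational`. -/
theorem summit_iff_forall_kernelOn :
    KontsevichZagierPeriods ↔
      ∀ (k : ℕ) (r : Fin k → (Σ n, IntegralRep n)), (∀ i, (r i).2.IsRational) →
        KernelOn (fun i => toFormalPeriod (of (r i).2)) := by
  sorry

/-- H2 (ideal certificate ⇒ sector kernel, S): if a set `G` of integer polynomials generates an
ideal containing every NUMERICAL relation of the values (N) and every member of `G` is realised in
`P` by moves (C), then Conjecture 1 holds on the sector. Proof: `P ∈ span G ≤ ker (aeval v)`. -/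
theorem kernelOn_of_certificate {k : ℕ} (v : Fin k → FormalPeriodRing)
    (G : Set (MvPolynomial (Fin k) ℤ))
    (hN : ∀ P : MvPolynomial (Fin k) ℤ, aeval (fun i => evalP (v i)) P = 0 → P ∈ Ideal.span G)
    (hC : ∀ Q ∈ G, aeval v Q = 0) : KernelOn v := by
  sorry

/-- H3 ((N) at height one — pure commutative algebra in the UFD `ℤ[X₀,…,X_k]`, M): an irreducible
`F` of positive degree in the last variable, vanishing at a point whose first `k` coordinates are
algebraically independent, divides every integer polynomial vanishing at that point.
(Gauss: `F` is irreducible in `Frac(ℤ[X_{<k}])[X_k]` (`IsPrimitive.irreducible_iff_irreducible_map_fraction_map`),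
hence the minimal polynomial of `x_k` up to a unit; pseudo-division `lc^N • P = Q F + R`, `R = 0` by
minimality + independence, then `F ∣ lc^N P`, `F` prime, `F ∤ lc`.) -/
theorem dvd_of_irreducible_of_algebraicIndependent {k : ℕ} (x : Fin (k + 1) → ℝ)
    (F : MvPolynomial (Fin (k + 1)) ℤ) (hF : Irreducible F)
    -- (`0 < degreeOf (Fin.last k) F` is implied: otherwise `hind` forces `F = 0`)
    (hind : AlgebraicIndependent ℚ (fun i : Fin k => x (Fin.castSucc i)))
    (hFx : aeval x F = 0) :
    ∀ P : MvPolynomial (Fin (k + 1)) ℤ, aeval x P = 0 → F ∣ P := by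
  sorry

/-- H3' (the one-relation sector, S from H0 + H2 + H3): generalises `lemniscaticSectorGlue_proof`
(`F = 4·X0·X1 − 2·X0² − X2`, Legendre) to ANY irreducible relation — no cancellation in `P` needed,
the leading coefficient is cancelled inside `ℤ[X]`. -/
theorem kernelOn_of_irreducible_relation {k : ℕ} (v : Fin (k + 1) → FormalPeriodRing)
    (F : MvPolynomial (Fin (k + 1)) ℤ) (hF : Irreducible F)
    (hind : AlgebraicIndependent ℚ (fun i : Fin k => evalP (v (Fin.castSucc i))))
    (hrel : aeval v F = 0) : KernelOn v := by
  sorry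

/-- H4 (tower step over a non-free base, S/M; companion of the landed `stub_saturationKernel`):
adjoining `t` to a subring `R₀` on which `evalP` is injective keeps injectivity, provided `t`
satisfies in `P` a MONIC relation over `R₀` (C) whose degree is the degree of the NUMBER `evalP t`
over the numbers `evalP R₀` (N). Proof: `Polynomial.modByMonic_add_div` + `degree_modByMonic_lt`. -/
theorem kernel_adjoin_of_monic (R₀ : Subring FormalPeriodRing)
    (hR₀ : ∀ x ∈ R₀, evalP x = 0 → x = 0) (t : FormalPeriodRing) (L : Polynomial R₀) (hL : L.Monic)
    (hmin : ∀ R : Polynomial R₀, R.degree < L.degree →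
      (R.map (evalP.comp R₀.subtype)).eval (evalP t) = 0 → R = 0)
    (hrel : Polynomial.eval₂ R₀.subtype t L = 0) :
    ∀ x ∈ Subring.closure ((R₀ : Set FormalPeriodRing) ∪ {t}), evalP x = 0 → x = 0 := by
  sorry

/-- H5 (height 0, S; generalises `kPiRingKernel` / `stub_piLineKernel`): an algebraically
independent family of VALUES roots a sector with no chain at all. -/
theorem kernelOn_of_algebraicIndependent {k : ℕ} (v : Fin k → FormalPeriodRing)
    (hind : AlgebraicIndependent ℚ (fun i => evalP (v i))) : KernelOn v := by
  sorry

/-- H6 = the LANDED torsion step (`stub_saturationKernel`, p99032), by name — nothing to prove: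
integer denominators are free because `P` is torsion-free. -/
example : ∀ (R₀ : Subring FormalPeriodRing) (T : Set FormalPeriodRing),
    (∀ x ∈ R₀, evalP x = 0 → x = 0) → (∀ t ∈ T, ∃ n : ℕ, n ≠ 0 ∧ n • t ∈ R₀) →
    ∀ x ∈ Subring.closure ((R₀ : Set FormalPeriodRing) ∪ T), evalP x = 0 → x = 0 :=
  stub_saturationKernel

/-- Bridge between the two shapes (S): the sector `Subring.closure (range v)` is the image of
`aeval v`, so `KernelOn v` is the closure-form kernel statement used by the stub. -/
theorem kernelOn_iff_closure {k : ℕ} (v : Fin k → FormalPeriodRing) :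
    KernelOn v ↔ ∀ x ∈ Subring.closure (Set.range v), evalP x = 0 → x = 0 := by
  sorry

/-- ASSEMBLY (real term): the stub from the universal certificate statement; the stub's own
hypothesis (the ring-join kernel, `↔ H₁ ↔ 0280`) is idle, exactly as `ringRemainder_iff_crux` says. -/
theorem stub_ringRemainder_of_forall_kernelOn
    (hall : ∀ (k : ℕ) (r : Fin k → (Σ n, IntegralRep n)), (∀ i, (r i).2.IsRational) →
        KernelOn (fun i => toFormalPeriod (of (r i).2))) :
    (∀ (p : IntegralRep 1), p.domain = Set.univ → (p.integrand = fun x => 1 / (1 + x 0 ^ 2)) →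
      ∀ x ∈ Subring.closure
          ({toFormalPeriod (of kRep), toFormalPeriod (of eRep), toFormalPeriod (of p)} ∪
            toFormalPeriod '' (genSetAdm 2 ∪ genSetAdm 4)),
        evalP x = 0 → x = 0) →
      KontsevichZagierPeriods :=
  fun _ => summit_iff_forall_kernelOn.mpr hall

/-- READ-BACK (S): the universal certificate statement IS the summit (so Plan A organises sector
landings; it does not close the stub). -/
theorem forall_kernelOn_iff_summit :
    (∀ (k : ℕ) (r : Fin k → (Σ n, IntegralRep n)), (∀ i, (r i).2.IsRational) →
        KernelOn (fun i => toFormalPeriod (of (r i).2))) ↔ KontsevichZagierPeriods :=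
  summit_iff_forall_kernelOn.symm

/-! ## Plan B — weaken-and-bootstrap: radical kernel + reducedness (and its dual, character form) -/

/-- Conjecture 1 UP TO AMPLIFICATION: every value-zero formal period is nilpotent
(some Fubini power is a relation). -/
def RadicalKernel : Prop := ∀ c : FormalPeriodRing, evalP c = 0 → IsNilpotent c

/-- B1 (S): tight two-piece split, sharper than `IsDomain P ∧ AlgebraicKernel` (Strategist §2):
the number theory sits in `RadicalKernel`, the structure of the calculus in `IsReduced P`. -/
theorem summit_iff_isReduced_and_radicalKernel :
    KontsevichZagierPeriods ↔ IsReduced FormalPeriodRing ∧ RadicalKernel := by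
  sorry

/-- B2 (dual / character form, S–M via `nilradical_eq_sInf` + residue fields): the radical kernel
statement says every CHARACTER of the formal period ring (every exotic "integration theory" obeying
the three rules and Fubini, with values in a field) kills what Lebesgue integration kills. -/
theorem radicalKernel_iff_characters :
    RadicalKernel ↔ ∀ (K : Type) [Field K] (φ : FormalPeriodRing →+* K) (c : FormalPeriodRing),
      evalP c = 0 → φ c = 0 := by
  sorry

end Summit.KontsevichZagierPeriods.Grothendieck.SectorComplementRingJoin.StubIdeas2

end
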